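import Mathlib
import Summits.QuantumFields.YangMills.Theses.FemtoCutoffLadder
import Summits.QuantumFields.YangMills.Theorems.FemtoCutoffLadderEventualSplitGluePw

/-!
# SKELETON «dyadic-eventual» for the crux `SubOctaveBounded` (stmt-QuantumFields-24085, route `FemtoCutoffLadder` rev 16; rung R2b1 = RECORD label)

Lead seat `ym-line-fcl-p1` g9 (2026-08-28).  The skeleton OF RECORD for 24085 after the planner's rev-13/16 resplit (ym-idea-1 g4 LINE 1
revised per critic idea-crit-4 P1/P2): the live children are

* `stub_dyadicNestedUpper : DyadicNestedUpper` — child stmt-QuantumFields-25766 BY NAME (the VARIATIONAL = upper direction at the dyadic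
  ratios `2^k`, uniform in `k` and in the base `L' ≥ L0`): `z(Λ, 2^k·L') ≤ z(Λ, L') + CΛ²`.  Kinematics landed by seats ym-line-sfw-p1 g10
  (`BlockPullback.*`, `Dirichlet.fine_gap_le_dirichlet_of_pullback`: `λ₁ ≥ λ₀ − ℰ_Ω(g'∘B_M)/Var_Ω(g'∘B_M)`) and ym-line-fcl-p3 g3 (`thin`,
  `UpStep.upStepAt_of_dynComparisonAt`); what is left is the RG comparison of the fine ground-state Dirichlet energy (or physical-time-1
  autocorrelation) of the pulled-back coarse excitation with the coarse excitation energy, to relative precision `O(Λ)`, UNIFORMLY IN `k`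
  (L–XL; the `k`-uniformity is lattice-vs-near-continuum control and is NOT needed by the leaf under the «up» architecture, see PICKED.md).
* `stub_eventualTowerDominancePw : EventualTowerDominancePw` — child stmt-QuantumFields-25890 BY NAME (pointwise eventual tower dominance:
  for incommensurable `L0 ≤ L' ≤ L < 2L'`, every coarse window coupling and `ε > 0`, SOME height `k` of the tower over `L` dominates:
  `z(Λ, L·2^k) ≥ z(Λ, L') − CΛ² − ε`).  HARDEST (XL): the planner's own sub-decomposition (two-towers, `Lines/dyadic_eventual_twotowers.lean`)
  is SelfTowerFrequentlyPw (lower direction along the own tower of EVERY base, frequently in height — the content of `OctaveStepDecay` re-widened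
  to all bases, rate-free) + CrossTowerAgreementPw (one-sided UNIVERSALITY of the value of the femto gap across regularisation towers —
  uniqueness-type, not in print).
Composition (kernel-checked, in the TREE): `eventualSplitGluePw_proof : DyadicNestedUpper → EventualTowerDominancePw → SubOctaveBounded`
(p607240; passes through the height-`k` member of the tower over `L` with `matchedCouplingExists_proof`, lets `ε ↓ 0`).
HONEST FRAMING: both stubs OPEN, behind `UVStabilityNonUniqueness`; R2b1 is a RECORD rung — not infinite volume, not a mass gap, not Clay.
No summit is proved by this line.  Lead's architecture verdict (PICKED.md): the leaf does not need 24085 at all under fcl-p3's «up» step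
(`CutoffLadder.femtoGapOfRecord_of_towerLadder_up`, p605028) — recommended to the planner; this skeleton is the line IF 24085 stays.
-/

set_option autoImplicit false

noncomputable section

open Summit.QuantumFields.YangMills.Theorems.FemtoTransferGap
open Summit.QuantumFields.YangMills.Theorems.FemtoCutoffLadder
open Summit.QuantumFields.YangMills.Theses.FemtoCutoffLadder

namespace Summit.QuantumFields.YangMills.Cruxes.SubOctaveBounded.DyadicEventual

/-- stub U (L–XL): the route child `DyadicNestedUpper` (stmt-QuantumFields-25766) BY NAME. -/
theorem stub_dyadicNestedUpper : DyadicNestedUpper := by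
  sorry

/-- stub T (HARDEST, XL): the route child `EventualTowerDominancePw` (stmt-QuantumFields-25890) BY NAME. -/
theorem stub_eventualTowerDominancePw : EventualTowerDominancePw := by
  sorry

/-- Kernel-checked composition (landed p607240): U and T give the crux `SubOctaveBounded` BY NAME. -/
theorem SubOctaveBounded_of (hU : DyadicNestedUpper) (hT : EventualTowerDominancePw) : SubOctaveBounded :=
  eventualSplitGluePw_proof hU hT

/-- ★ The crux BY NAME from exactly the two declared stubs. -/
theorem SubOctaveBounded_holds_of_stubs : SubOctaveBounded :=
  SubOctaveBounded_of stub_dyadicNestedUpper stub_eventualTowerDominancePw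

end Summit.QuantumFields.YangMills.Cruxes.SubOctaveBounded.DyadicEventual

end
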